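import Literature.Barriers.RiemannHypothesis.JensenPolynomialsKimProofs
import Literature.Barriers.RiemannHypothesis.JensenPolynomialsChasse
import Literature.NumberTheory.LFunctions.RiemannXiOrderProofs
import Literature.NumberTheory.LFunctions.XiJensenRows
import Mathlib.Analysis.SpecialFunctions.Pow.Real
import HarnessLib

/-!
# Effective Kim–Lee for `ξ₁`: an explicit zero-free criterion for the non-real zeros of `ξ₁⁽ⁿ⁾`

RH-FREE (line 1, cell rh-jensen discipline; bears_on LADDER-RH J-P, the column's next rung «explicit
Kim–Lee band»; nothing here bears on the truth of RH — under RH every `ξ₁⁽ⁿ⁾` has only real zeros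
and the statements below are vacuous; their content is RH-free complex analysis).

`ξ₁ = xiSq` (`ξ(s) = ξ₁((s-½)²)`, tree `riemannXi_eq_xiSq`), real entire of order `< 1`, whose zeros
`(ρ-½)²` lie in the parabola region `|Im z| ≤ √‖z‖` (tree `exists_zero_of_xiSq_eq_zero`). The tree
proves Kim's theorem for the STRIP case (`Literature/Barriers/RiemannHypothesis/JensenPolynomialsKimProofs.lean`,
Ki–Kim 2000 §2: backward Jensen chain + Gontcharoff's estimate + Cauchy's estimate). This file
transplants the argument to the PARABOLA case with every constant explicit:

* `im_eq_zero_of_chain_estimate` — **master lemma (general `f`).** Let `f` be real entire of order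
  `< 2`, no derivative vanishing identically, with `|Im z| ≤ √‖z‖` at every zero of `f`. Fix
  `u ∈ ℂ`, `n ≥ 1`, `R > 0`, put `s = 1 + √n`, `V̄ = s (s + √R)`,
  `r̄ = (R + V̄ + ‖u‖) + e² (R + 2V̄ + ‖u‖)`, and let `B` bound `‖f‖` on `‖ζ‖ ≤ r̄`. If
  `B · e^{-2n} < ‖f u‖` then every zero of `f⁽ⁿ⁾` in `‖w‖ < R` is real. (Chain `z₀, …, zₙ = w`;
  variation `V ≤ Im z₀ (1+√n)`; the root zero has `Im z₀ ≤ √‖z₀‖ ≤ √(R+V)`, whence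
  `Im z₀ ≤ s + √R` and `V ≤ V̄`; Gontcharoff at `u` on the ball of radius `R + V̄ + ‖u‖` with Cauchy
  radius `e²(R + 2V̄ + ‖u‖)` gives `‖f u‖ ≤ B e^{-2n}`.)
* `norm_xiSq_le_explicit` — `‖ξ₁(z)‖ ≤ 8e⁶ · exp(4(½ + √‖z‖) · log(3/2 + √‖z‖))` (the tree's
  explicit Titchmarsh (2.12.3) on `Re s ≥ ½`, `norm_riemannXi_le_of_half_le_re`, at `s = ½ + √z`).
* `xiSq_one_quarter` — the anchor `ξ₁(¼) = ξ(1) = ½`.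
* `xiSq_derivZeros_real_of_explicit` — **effective Kim–Lee for `ξ₁`, master form:** for `n ≥ 1`,
  `R > 0` and any `r ≥ (R + V̄ + ¼) + e²(R + 2V̄ + ¼)`, if
  `16 e⁶ · exp(4(½ + √r) log(3/2 + √r)) < e^{2n}` then every NON-REAL zero `w` of `ξ₁⁽ⁿ⁾` has
  `R ≤ ‖w‖`. No definition is introduced; the radius instance `R = (n / log n)²/64` for
  `n ≥ n₁` (the cell's `XiDerivNonrealZeroFar` shape) is pure real arithmetic on top of this and is
  filed separately.

Provenance: proof route of the cell memo `HOME/rh-jensen-idea-2/NEGATION-LENS.md` §2 (planner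
rh-jensen-idea-2 g0, 2026-08-26: «Kim–Lee 2021 Thm. 2(ii) made effective»), carried out by
prover-rh-jensen-eng-2-g4-0. AI-produced formalisation; AI review is weaker than expert review.
References: H. Ki, Y.-O. Kim, Duke Math. J. 104 (2000) §2 (Lemma 2.1, (2.3), (2.5), Thm. 2.1);
Y.-O. Kim, J. Lee, arXiv:2105.05386, Thm. 2 (ii); E. C. Titchmarsh, §2.12 (2.12.3).
-/

noncomputable section

open Complex Filter Metric Set Topology
open scoped ComplexConjugate

set_option linter.dupNamespace false

namespace Summit.RiemannHypothesis.RiemannHypothesis.Theorems.JensenPolynomials.EffectiveKimLee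

open Literature.NumberTheory.LFunctions Literature.Analysis.Complex
  Literature.Barriers.RiemannHypothesis

/-! ## Elementary bookkeeping -/

/-- If `0 ≤ s`, `0 ≤ R` and `y² ≤ R + s·y` then `y ≤ s + √R`. -/
theorem le_add_sqrt_of_sq_le {y s R : ℝ} (hs : 0 ≤ s) (hR : 0 ≤ R)
    (h : y ^ 2 ≤ R + s * y) : y ≤ s + Real.sqrt R := by
  by_contra hcon
  push Not at hcon
  have hR' : Real.sqrt R ^ 2 = R := Real.sq_sqrt hR
  have hsq : 0 ≤ Real.sqrt R := Real.sqrt_nonneg R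
  -- `y - s > √R ≥ 0`, so `(y - s)² > R`, but `(y - s)² ≤ (y - s) y ≤ R`... contradiction
  have h1 : Real.sqrt R < y - s := by linarith
  have h2 : R < (y - s) ^ 2 := by
    calc R = Real.sqrt R ^ 2 := hR'.symm
      _ < (y - s) ^ 2 := by
          apply pow_lt_pow_left₀ h1 hsq two_ne_zero
  nlinarith

/-! ## The master lemma (general real entire `f` with zeros in the parabola region) -/

/-- **Master lemma (explicit Ki–Kim chain estimate in the parabola case).** Let `f` be entire with
`‖f z‖ ≤ C e^{‖z‖^ρ}` (`0 ≤ ρ < 2`), real on `ℝ`, no derivative vanishing identically, and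
`|Im z| ≤ √‖z‖` at every zero of `f`. Let `u ∈ ℂ`, `n ≥ 1`, `R > 0`, `s = 1 + √n`, `V̄ = s(s + √R)`,
`r̄ = (R + V̄ + ‖u‖) + e²(R + 2V̄ + ‖u‖)`, and suppose `‖f ζ‖ ≤ B` for `‖ζ‖ ≤ r̄`. If
`B · e^{-2n} < ‖f u‖`, then every zero `w` of `f⁽ⁿ⁾` with `‖w‖ < R` is real. -/
theorem im_eq_zero_of_chain_estimate {f : ℂ → ℂ} (hf : Differentiable ℂ f) {ρ C : ℝ}
    (hρ0 : 0 ≤ ρ) (hρ : ρ < 2) (hgr : ∀ z, ‖f z‖ ≤ C * Real.exp (‖z‖ ^ ρ))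
    (hreal : ∀ x : ℝ, (f x).im = 0) (hnz : ∀ k : ℕ, iteratedDeriv k f ≠ 0)
    (hpar : ∀ z : ℂ, f z = 0 → |z.im| ≤ Real.sqrt ‖z‖)
    (u : ℂ) {n : ℕ} (hn : 1 ≤ n) {R : ℝ} (hR : 0 < R) {B : ℝ}
    (hB : ∀ ζ : ℂ, ‖ζ‖ ≤ (R + (1 + Real.sqrt n) * (1 + Real.sqrt n + Real.sqrt R) + ‖u‖) +
        Real.exp 2 * (R + 2 * ((1 + Real.sqrt n) * (1 + Real.sqrt n + Real.sqrt R)) + ‖u‖) →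
      ‖f ζ‖ ≤ B)
    (hlt : B * Real.exp (-2 * (n : ℝ)) < ‖f u‖) :
    ∀ w : ℂ, iteratedDeriv n f w = 0 → ‖w‖ < R → w.im = 0 := by
  -- abbreviations
  set s : ℝ := 1 + Real.sqrt n with hs
  set Vb : ℝ := s * (s + Real.sqrt R) with hVb
  set ρK : ℝ := R + Vb + ‖u‖ with hρK
  set Λb : ℝ := R + 2 * Vb + ‖u‖ with hΛb
  have hs1 : 1 ≤ s := by have := Real.sqrt_nonneg (n : ℝ); linarith
  have hs0 : 0 ≤ s := by linarith
  have hsqR : 0 ≤ Real.sqrt R := Real.sqrt_nonneg R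
  have hVb0 : 0 ≤ Vb := by positivity
  have hΛpos : 0 < Λb := by positivity
  -- the key step: no zero with `Im w > 0`
  have key : ∀ w : ℂ, 0 < w.im → iteratedDeriv n f w = 0 → ‖w‖ < R → False := by
    intro w hwim hw0 hwR
    obtain ⟨z, hzn, hzero, hpos, hrel⟩ := exists_jensen_chain hf hρ0 hρ hgr hreal hnz n hwim hw0
    -- the variation of the chain
    set V : ℝ := ∑ k ∈ Finset.range n, ‖z k - z (k + 1)‖ with hV
    have hV0 : 0 ≤ V := Finset.sum_nonneg fun k _ ↦ norm_nonneg _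
    have hVle : V ≤ (z 0).im * (1 + Real.sqrt n) := chain_variation_le hpos hrel
    -- all points of the chain are within `V` of `w = z n`
    have hzk : ∀ k ≤ n, ‖z k - z n‖ ≤ V := by
      intro k hk
      have h := dist_le_Ico_sum_dist z hk
      rw [dist_eq_norm] at h
      refine h.trans ?_
      simp only [dist_eq_norm]
      refine Finset.sum_le_sum_of_subset_of_nonneg ?_ fun i _ _ ↦ norm_nonneg _
      rw [Finset.range_eq_Ico]
      exact Finset.Ico_subset_Ico_left (Nat.zero_le _)
    have hznorm : ∀ k ≤ n, ‖z k‖ ≤ R + V := by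
      intro k hk
      calc ‖z k‖ = ‖(z k - z n) + z n‖ := by rw [sub_add_cancel]
        _ ≤ ‖z k - z n‖ + ‖z n‖ := norm_add_le _ _
        _ ≤ V + R := add_le_add (hzk k hk) (by rw [hzn]; exact hwR.le)
        _ = R + V := add_comm _ _
    -- the root zero: `y = Im z₀ ≤ √‖z₀‖ ≤ √(R + V)`, so `y ≤ s + √R` and `V ≤ V̄`
    set y : ℝ := (z 0).im with hy
    have hy0 : 0 < y := hpos 0 (Nat.zero_le _)
    have hfz0 : f (z 0) = 0 := by simpa using hzero 0 (Nat.zero_le _)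
    have hy1 : y ≤ Real.sqrt (R + V) := by
      have h1 : |(z 0).im| ≤ Real.sqrt ‖z 0‖ := hpar _ hfz0
      rw [abs_of_pos hy0] at h1
      exact h1.trans (Real.sqrt_le_sqrt (hznorm 0 (Nat.zero_le _)))
    have hy2 : y ^ 2 ≤ R + s * y := by
      have h1 : y ^ 2 ≤ R + V := by
        calc y ^ 2 ≤ Real.sqrt (R + V) ^ 2 := pow_le_pow_left₀ hy0.le hy1 2
          _ = R + V := Real.sq_sqrt (by linarith)
      have h2 : V ≤ s * y := by rw [hs, mul_comm]; exact hVle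
      linarith
    have hy3 : y ≤ s + Real.sqrt R := le_add_sqrt_of_sq_le hs0 hR.le hy2
    have hVVb : V ≤ Vb := by
      calc V ≤ y * (1 + Real.sqrt n) := hVle
        _ = s * y := by rw [hs, mul_comm]
        _ ≤ s * (s + Real.sqrt R) := mul_le_mul_of_nonneg_left hy3 hs0
    -- the convex set and memberships
    set Kset : Set ℂ := closedBall (0 : ℂ) ρK with hKset
    have hKconv : Convex ℝ Kset := convex_closedBall _ _
    have hmemz : ∀ k ≤ n, z k ∈ Kset := fun k hk ↦ by
      rw [hKset, mem_closedBall_zero_iff]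
      have := hznorm k hk
      rw [hρK]; linarith [norm_nonneg u]
    have hmemu : u ∈ Kset := by
      rw [hKset, mem_closedBall_zero_iff, hρK]; linarith
    -- write `n = j + 1`
    obtain ⟨j, rfl⟩ : ∃ j, n = j + 1 := ⟨n - 1, by omega⟩
    -- Cauchy's estimate on `Kset` with radius `σ = e² Λ̄`
    set σ : ℝ := Real.exp 2 * Λb with hσ
    have hσpos : 0 < σ := by positivity
    have hM : ∀ v ∈ Kset, ‖iteratedDeriv (j + 1) f v‖ ≤ (j + 1).factorial * B / σ ^ (j + 1) := by
      intro v hv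
      refine Complex.norm_iteratedDeriv_le_of_forall_mem_sphere_norm_le (j + 1) hσpos
        hf.diffContOnCl fun ζ hζ ↦ hB ζ ?_
      rw [hKset, mem_closedBall_zero_iff] at hv
      have h1 : ‖ζ - v‖ = σ := mem_sphere_iff_norm.1 hζ
      calc ‖ζ‖ = ‖(ζ - v) + v‖ := by rw [sub_add_cancel]
        _ ≤ ‖ζ - v‖ + ‖v‖ := norm_add_le _ _
        _ ≤ σ + ρK := by rw [h1]; linarith
        _ = ρK + Real.exp 2 * Λb := by rw [hσ]; ring
    -- Gontcharoff
    have hG := gontcharoff_norm_le hKconv j hf z (fun k hk ↦ hmemz k (by omega))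
      (fun k hk ↦ hzero k (by omega)) hM hmemu
    -- the variation entering Gontcharoff's estimate is at most `Λ̄`
    have hvar : ‖u - z 0‖ + ∑ k ∈ Finset.range j, ‖z k - z (k + 1)‖ ≤ Λb := by
      have h1 : ∑ k ∈ Finset.range j, ‖z k - z (k + 1)‖ ≤ V := by
        rw [hV]
        exact Finset.sum_le_sum_of_subset_of_nonneg (Finset.range_subset_range.2 (Nat.le_succ j))
          fun i _ _ ↦ norm_nonneg _
      have h2 : ‖u - z 0‖ ≤ ‖u‖ + (R + V) :=
        (norm_sub_le _ _).trans (add_le_add le_rfl (hznorm 0 (Nat.zero_le _)))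
      rw [hΛb]; linarith
    have hvar0 : 0 ≤ ‖u - z 0‖ + ∑ k ∈ Finset.range j, ‖z k - z (k + 1)‖ := by positivity
    -- `B ≥ 0`
    have hB0 : 0 ≤ B := by
      have h := hB 0 (by simp only [norm_zero]; positivity)
      exact (norm_nonneg _).trans h
    -- combine: `‖f u‖ ≤ B (Λ̄/σ)^{j+1} = B e^{-2(j+1)}`
    have hΛσ : Λb / σ = Real.exp (-2) := by
      rw [hσ, Real.exp_neg]; field_simp
    have hstep : ‖f u‖ ≤ B * Real.exp (-2) ^ (j + 1) := by
      calc ‖f u‖ ≤ (j + 1).factorial * B / σ ^ (j + 1) *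
            (‖u - z 0‖ + ∑ k ∈ Finset.range j, ‖z k - z (k + 1)‖) ^ (j + 1) /
              (j + 1).factorial := hG
        _ ≤ (j + 1).factorial * B / σ ^ (j + 1) * Λb ^ (j + 1) / (j + 1).factorial := by
            gcongr
        _ = B * (Λb / σ) ^ (j + 1) := by
            have hfact : ((j + 1).factorial : ℝ) ≠ 0 := by positivity
            rw [div_pow]
            field_simp
        _ = B * Real.exp (-2) ^ (j + 1) := by rw [hΛσ]
    have hexp : Real.exp (-2) ^ (j + 1) = Real.exp (-2 * ((j + 1 : ℕ) : ℝ)) := by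
      rw [← Real.exp_nat_mul]; congr 1; push_cast; ring
    rw [hexp] at hstep
    exact absurd hlt (not_lt.2 hstep)
  -- reduction to `Im w > 0` by reflection
  intro w hw hwR
  by_contra him
  rcases lt_or_gt_of_ne him with hneg | hpos
  · have hrefl : iteratedDeriv n f (conj w) = conj (iteratedDeriv n f w) :=
      apply_conj_eq_conj (differentiable_iteratedDeriv_of_entire hf n)
        (im_iteratedDeriv_ofReal hf hreal n) w
    refine key (conj w) (by simpa using hneg) (by rw [hrefl, hw, map_zero]) ?_
    simpa using hwR
  · exact key w hpos hw hwR

/-! ## The `ξ₁` data: explicit growth, anchor, parabola -/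

/-- **Explicit growth of `ξ₁`:** `‖ξ₁(z)‖ ≤ 8e⁶ · exp(4(½ + √‖z‖) · log(3/2 + √‖z‖))` — the tree's
explicit Titchmarsh (2.12.3) `‖ξ(s)‖ ≤ 8e⁶ exp(4‖s‖ log(1+‖s‖))` on `Re s ≥ ½`
(`norm_riemannXi_le_of_half_le_re`) at `s = ½ + √z` (principal branch, `Re √z ≥ 0`). -/
theorem norm_xiSq_le_explicit (z : ℂ) :
    ‖xiSq z‖ ≤ 8 * Real.exp 6 *
      Real.exp (4 * (1 / 2 + Real.sqrt ‖z‖) * Real.log (3 / 2 + Real.sqrt ‖z‖)) := by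
  set w : ℂ := z ^ (2⁻¹ : ℂ) with hw
  have hw2 : w ^ 2 = z := Complex.cpow_nat_inv_pow z two_ne_zero
  have hnw : ‖w‖ = Real.sqrt ‖z‖ := by
    rw [hw, show (2⁻¹ : ℂ) = ((2⁻¹ : ℝ) : ℂ) by push_cast; ring, Complex.norm_cpow_real,
      Real.sqrt_eq_rpow]
    norm_num
  have hre : 1 / 2 ≤ ((1 / 2 : ℂ) + w).re := by
    rw [Complex.add_re, hw, Complex.cpow_inv_two_re]
    have h0 : 0 ≤ Real.sqrt ((‖z‖ + z.re) / 2) := Real.sqrt_nonneg _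
    have h1 : ((1 / 2 : ℂ)).re = 1 / 2 := by norm_num
    rw [h1]; linarith
  rw [xiSq_eq_of_sq_eq hw2]
  refine (norm_riemannXi_le_of_half_le_re hre).trans ?_
  have hn : ‖(1 / 2 : ℂ) + w‖ ≤ 1 / 2 + Real.sqrt ‖z‖ := by
    refine (norm_add_le _ _).trans ?_
    rw [hnw]; norm_num
  have hn0 : 0 ≤ ‖(1 / 2 : ℂ) + w‖ := norm_nonneg _
  have hsq0 : 0 ≤ Real.sqrt ‖z‖ := Real.sqrt_nonneg _
  have hlog0 : 0 ≤ Real.log (1 + ‖(1 / 2 : ℂ) + w‖) := Real.log_nonneg (by linarith)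
  have hlog : Real.log (1 + ‖(1 / 2 : ℂ) + w‖) ≤ Real.log (3 / 2 + Real.sqrt ‖z‖) :=
    Real.log_le_log (by linarith) (by linarith)
  gcongr 8 * Real.exp 6 * Real.exp ?_
  calc 4 * ‖(1 / 2 : ℂ) + w‖ * Real.log (1 + ‖(1 / 2 : ℂ) + w‖)
      ≤ 4 * (1 / 2 + Real.sqrt ‖z‖) * Real.log (1 + ‖(1 / 2 : ℂ) + w‖) := by gcongr
    _ ≤ 4 * (1 / 2 + Real.sqrt ‖z‖) * Real.log (3 / 2 + Real.sqrt ‖z‖) := by gcongr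

/-- **The anchor:** `ξ₁(¼) = ξ(1) = ½` (tree `riemannXi_eq_xiSq`, `riemannXi_one`). -/
theorem xiSq_one_quarter : xiSq (1 / 4) = 1 / 2 := by
  have h := riemannXi_eq_xiSq 1
  rw [riemannXi_one] at h
  rw [h]; norm_num

/-- The zeros of `ξ₁` lie in the parabola region `|Im z| ≤ √‖z‖`: they are `(ρ-½)²` with
`0 < Re ρ < 1`, so `Im² = 4(Re ρ-½)² (Im ρ)² ≤ (Im ρ)² ≤ ‖z‖` (tree `exists_zero_of_xiSq_eq_zero`). -/
theorem abs_im_le_sqrt_norm_of_xiSq_eq_zero {z : ℂ} (hz : xiSq z = 0) :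
    |z.im| ≤ Real.sqrt ‖z‖ := by
  obtain ⟨ρ, _hζ, h0, h1, rfl⟩ := exists_zero_of_xiSq_eq_zero hz
  have him : ((ρ - 1 / 2) ^ 2).im = 2 * (ρ.re - 1 / 2) * ρ.im := by
    simp [sq, Complex.mul_im]; ring
  have hnorm : ‖(ρ - 1 / 2) ^ 2‖ = (ρ.re - 1 / 2) ^ 2 + ρ.im ^ 2 := by
    rw [norm_pow, Complex.sq_norm, Complex.normSq_apply]; simp; ring
  have hx : (ρ.re - 1 / 2) ^ 2 ≤ 1 / 4 := by nlinarith
  have key : ((ρ - 1 / 2) ^ 2).im ^ 2 ≤ ‖(ρ - 1 / 2) ^ 2‖ := by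
    rw [him, hnorm]; nlinarith [sq_nonneg ρ.im, sq_nonneg (ρ.re - 1 / 2)]
  calc |((ρ - 1 / 2) ^ 2).im| = Real.sqrt (((ρ - 1 / 2) ^ 2).im ^ 2) :=
        (Real.sqrt_sq_eq_abs _).symm
    _ ≤ Real.sqrt ‖(ρ - 1 / 2) ^ 2‖ := Real.sqrt_le_sqrt key

/-- `ξ₁` is real on the real axis (from `xiSq_conj`). -/
theorem im_xiSq_ofReal (x : ℝ) : (xiSq x).im = 0 := by
  have h := xiSq_conj x
  rw [Complex.conj_ofReal] at h
  exact Complex.conj_eq_iff_im.1 h.symm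

/-- No derivative of `ξ₁` vanishes identically (`8 ξ₁⁽ᵏ⁾(0) = γ(k) ≠ 0`). -/
theorem iteratedDeriv_xiSq_ne_zero (k : ℕ) : iteratedDeriv k xiSq ≠ 0 := by
  intro h
  have := eight_mul_iteratedDeriv_xiSq_zero_ne k
  rw [h] at this
  simp at this

/-! ## Effective Kim–Lee for `ξ₁`, master form -/

/-- **Effective Kim–Lee for `ξ₁` (master form, RH-FREE).** Let `n ≥ 1`, `R > 0`, and let `r` be any
number with `(R + V̄ + ¼) + e²(R + 2V̄ + ¼) ≤ r`, `V̄ = (1 + √n)(1 + √n + √R)`. If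
`16 e⁶ · exp(4(½ + √r) log(3/2 + √r)) < e^{2n}`, then every non-real zero `w` of `ξ₁⁽ⁿ⁾` satisfies
`R ≤ ‖w‖`. (Master lemma `im_eq_zero_of_chain_estimate` for `f = ξ₁` with the anchor `u = ¼`,
`ξ₁(¼) = ½`, the explicit growth `norm_xiSq_le_explicit`, and the parabola
`abs_im_le_sqrt_norm_of_xiSq_eq_zero`.) -/
theorem xiSq_derivZeros_real_of_explicit {n : ℕ} (hn : 1 ≤ n) {R r : ℝ} (hR : 0 < R)
    (hr : (R + (1 + Real.sqrt n) * (1 + Real.sqrt n + Real.sqrt R) + 1 / 4) +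
        Real.exp 2 * (R + 2 * ((1 + Real.sqrt n) * (1 + Real.sqrt n + Real.sqrt R)) + 1 / 4) ≤ r)
    (hineq : 16 * Real.exp 6 * Real.exp (4 * (1 / 2 + Real.sqrt r) * Real.log (3 / 2 + Real.sqrt r))
        < Real.exp (2 * (n : ℝ))) :
    ∀ w : ℂ, iteratedDeriv n xiSq w = 0 → w.im ≠ 0 → R ≤ ‖w‖ := by
  intro w hw him
  by_contra hlt
  push Not at hlt
  obtain ⟨C, hC⟩ := norm_xiSq_le
  set B : ℝ := 8 * Real.exp 6 * Real.exp (4 * (1 / 2 + Real.sqrt r) *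
    Real.log (3 / 2 + Real.sqrt r)) with hBdef
  have hnorm_u : ‖(1 / 4 : ℂ)‖ = 1 / 4 := by
    rw [show (1 / 4 : ℂ) = ((1 / 4 : ℝ) : ℂ) by push_cast; ring, Complex.norm_real]
    norm_num
  have hB : ∀ ζ : ℂ, ‖ζ‖ ≤ (R + (1 + Real.sqrt n) * (1 + Real.sqrt n + Real.sqrt R) + ‖(1 / 4 : ℂ)‖) +
      Real.exp 2 * (R + 2 * ((1 + Real.sqrt n) * (1 + Real.sqrt n + Real.sqrt R)) + ‖(1 / 4 : ℂ)‖) →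
      ‖xiSq ζ‖ ≤ B := by
    intro ζ hζ
    rw [hnorm_u] at hζ
    have hζ' : ‖ζ‖ ≤ r := hζ.trans hr
    refine (norm_xiSq_le_explicit ζ).trans ?_
    have h1 : Real.sqrt ‖ζ‖ ≤ Real.sqrt r := Real.sqrt_le_sqrt hζ'
    have h0 : 0 ≤ Real.sqrt ‖ζ‖ := Real.sqrt_nonneg _
    have hlog0 : 0 ≤ Real.log (3 / 2 + Real.sqrt ‖ζ‖) := Real.log_nonneg (by linarith)
    rw [hBdef]
    gcongr 8 * Real.exp 6 * Real.exp ?_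
    calc 4 * (1 / 2 + Real.sqrt ‖ζ‖) * Real.log (3 / 2 + Real.sqrt ‖ζ‖)
        ≤ 4 * (1 / 2 + Real.sqrt r) * Real.log (3 / 2 + Real.sqrt ‖ζ‖) := by gcongr
      _ ≤ 4 * (1 / 2 + Real.sqrt r) * Real.log (3 / 2 + Real.sqrt r) := by gcongr
  have hanchor : ‖xiSq (1 / 4 : ℂ)‖ = 1 / 2 := by
    rw [xiSq_one_quarter]
    rw [show (1 / 2 : ℂ) = ((1 / 2 : ℝ) : ℂ) by push_cast; ring, Complex.norm_real]
    norm_num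
  have hlt' : B * Real.exp (-2 * (n : ℝ)) < ‖xiSq (1 / 4 : ℂ)‖ := by
    rw [hanchor]
    have hpos : 0 < Real.exp (2 * (n : ℝ)) := Real.exp_pos _
    have h2 : B * Real.exp (-2 * (n : ℝ)) = (2 * B) / Real.exp (2 * (n : ℝ)) / 2 := by
      rw [show (-2 * (n : ℝ)) = -(2 * (n : ℝ)) by ring, Real.exp_neg]
      field_simp
    rw [h2]
    have h3 : 2 * B < Real.exp (2 * (n : ℝ)) := by
      rw [hBdef]; linarith
    have h4 : 2 * B / Real.exp (2 * (n : ℝ)) < 1 := (div_lt_one hpos).2 h3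
    linarith
  have := im_eq_zero_of_chain_estimate differentiable_xiSq (by norm_num : (0 : ℝ) ≤ 7 / 8)
    (by norm_num : (7 / 8 : ℝ) < 2) hC im_xiSq_ofReal iteratedDeriv_xiSq_ne_zero
    (fun z hz ↦ abs_im_le_sqrt_norm_of_xiSq_eq_zero hz) (1 / 4 : ℂ) hn hR hB hlt' w hw hlt
  exact him this

end Summit.RiemannHypothesis.RiemannHypothesis.Theorems.JensenPolynomials.EffectiveKimLee
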